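import Summits.ValiantsHypothesis.ValiantsHypothesis.Theorems.RigidityForcesSymmetryGrenetFirstOrderRankRigidPermSlices

/-!
# Route RigidityForcesSymmetry — `GrenetFirstOrderRankRigid` (item stmt-ValiantsHypothesis-21029),
line `grenet_gauge`: stub `stub_linearRigid`, step 5 (block II) — the master identity of an
overlap block `(A, k₀)` at an arbitrary point

For the crux line `Cruxes/GrenetFirstOrderRankRigid/Lines/grenet_gauge.lean` (blueprint
`Lines/grenet_gauge-stub_linearRigid-PROOF.md`, §5, block II; NOTES "TYPE II FORMAL PLAN").
For a homogeneous direction `A'` that is Zariski-tangent at Grenet's pencil and supported on the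
tail/head positions, the weight block of `(A, k₀)` (`u = |A| + k₀ ≤ n`, `|A| ≥ 1`) consists of the
TAIL-SHAPED entries `ρ[C', p]` (row `(A ⊔ C') - p`, column `C' ⊆ Aᶜ`, `|C'| = k₀`, variable `(p, u-1)`)
and the HEAD-SHAPED entries `κ[C', p]` (row `A ⊔ C'`, column `C' + p`, variable `(p, k₀)`), and the
tangency identity of the block, evaluated at any point `P`, reads
`Σ_{tail-shaped x} A'(x) · (term x)(P) + Σ_{head-shaped x} A'(x) · (term x)(P) = 0`
(`grenet_blockII_master`).  No new definitions.  VP ≠ VNP is not moved by this file.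
-/

noncomputable section

open MvPolynomial Matrix Finset

namespace Summit.ValiantsHypothesis.Theorems.RigidityForcesSymmetry.GrenetGauge

open Literature.Computability.AlgebraicComplexity

variable {k : Type*} [CommRing k] [IsDomain k] {n N : ℕ} (e : Finset (Fin n) ≃ Fin (N + 1))

/-- Tail-shaped and head-shaped entries of one block are different entries (their columns have
`k₀` resp. `k₀ + 1` elements). [folklore] -/
theorem blockII_disjoint_shapes (A : Finset (Fin n)) (k₀ u : ℕ) :
    Disjoint
      (univ.filter fun x : Fin N × Fin N × (Fin n × Fin n) => (x.2.2.1 ∉ e.symm ((e univ).succAbove x.1) ∧ e.symm ((e ∅).succAbove x.2.1) ⊆ Aᶜ ∧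
        (e.symm ((e ∅).succAbove x.2.1)).card = k₀ ∧
        insert x.2.2.1 (e.symm ((e univ).succAbove x.1)) = A ∪ e.symm ((e ∅).succAbove x.2.1) ∧ (x.2.2.2 : ℕ) = u - 1))
      (univ.filter fun x : Fin N × Fin N × (Fin n × Fin n) => (x.2.2.1 ∈ e.symm ((e ∅).succAbove x.2.1) ∧ (e.symm ((e ∅).succAbove x.2.1)).erase x.2.2.1 ⊆ Aᶜ ∧
        ((e.symm ((e ∅).succAbove x.2.1)).erase x.2.2.1).card = k₀ ∧
        e.symm ((e univ).succAbove x.1) = A ∪ (e.symm ((e ∅).succAbove x.2.1)).erase x.2.2.1 ∧ (x.2.2.2 : ℕ) = k₀)) := by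
  refine Finset.disjoint_filter.mpr fun x _ ht hh => ?_
  have h1 := ht.2.2.1
  have h2 := hh.2.2.1
  rw [Finset.card_erase_of_mem hh.1, h1] at h2
  have h3 := Finset.card_pos.mpr ⟨_, hh.1⟩
  rw [h1] at h3
  omega

/-- **The master identity of the overlap block `(A, k₀)`.**  For a homogeneous direction `A'`,
Zariski-tangent at Grenet's pencil and supported on the tail/head positions, and for every point `P`,
`Σ_{tail-shaped x} A'(x) · (term x)(P) + Σ_{head-shaped x} A'(x) · (term x)(P) = 0`, where
`term x = per · W (C j) (R i) · x_v - W ∅ (R i) · x_v · W (C j) univ` is the cofactor term of the entry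
`x = (i, j, v)`. [cite: Grenet2011, Thm. 1] -/
theorem grenet_blockII_master (hn : n ≠ 0) (hN : 2 ^ n = N + 1)
    (A' : Fin n × Fin n → Matrix (Fin N) (Fin N) k)
    (htr : ((Grenet.repr k n e).adjugate * ∑ v, (X v : MvPolynomial (Fin n × Fin n) k) • (A' v).map C).trace = 0)
    (hsupp : ∀ (w : Fin n × Fin n) (a b : Fin N), A' w a b ≠ 0 →
      (w.1 ∉ e.symm ((e univ).succAbove a) ∧ (w.2 : ℕ) = (e.symm ((e univ).succAbove a)).card) ∨
      (w.1 ∈ e.symm ((e ∅).succAbove b) ∧ (e.symm ((e ∅).succAbove b)).card = (w.2 : ℕ) + 1))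
    (A : Finset (Fin n)) (hA : 0 < A.card) (k₀ : ℕ) {u : ℕ} (huA : A.card + k₀ = u) (hu : u ≤ n)
    (P : Fin n × Fin n → k) :
    ∑ x ∈ univ.filter (fun x : Fin N × Fin N × (Fin n × Fin n) => (x.2.2.1 ∉ e.symm ((e univ).succAbove x.1) ∧ e.symm ((e ∅).succAbove x.2.1) ⊆ Aᶜ ∧
        (e.symm ((e ∅).succAbove x.2.1)).card = k₀ ∧
        insert x.2.2.1 (e.symm ((e univ).succAbove x.1)) = A ∪ e.symm ((e ∅).succAbove x.2.1) ∧ (x.2.2.2 : ℕ) = u - 1)),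
        A' x.2.2 x.1 x.2.1 * eval P (perPoly (Fin n) k * (1 - Grenet.adj k n).adjugate (e.symm ((e ∅).succAbove x.2.1)) (e.symm ((e univ).succAbove x.1)) * X x.2.2
          - (1 - Grenet.adj k n).adjugate ∅ (e.symm ((e univ).succAbove x.1)) * X x.2.2
            * (1 - Grenet.adj k n).adjugate (e.symm ((e ∅).succAbove x.2.1)) univ)
      + ∑ x ∈ univ.filter (fun x : Fin N × Fin N × (Fin n × Fin n) => (x.2.2.1 ∈ e.symm ((e ∅).succAbove x.2.1) ∧ (e.symm ((e ∅).succAbove x.2.1)).erase x.2.2.1 ⊆ Aᶜ ∧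
        ((e.symm ((e ∅).succAbove x.2.1)).erase x.2.2.1).card = k₀ ∧
        e.symm ((e univ).succAbove x.1) = A ∪ (e.symm ((e ∅).succAbove x.2.1)).erase x.2.2.1 ∧ (x.2.2.2 : ℕ) = k₀)),
        A' x.2.2 x.1 x.2.1 * eval P (perPoly (Fin n) k * (1 - Grenet.adj k n).adjugate (e.symm ((e ∅).succAbove x.2.1)) (e.symm ((e univ).succAbove x.1)) * X x.2.2
          - (1 - Grenet.adj k n).adjugate ∅ (e.symm ((e univ).succAbove x.1)) * X x.2.2
            * (1 - Grenet.adj k n).adjugate (e.symm ((e ∅).succAbove x.2.1)) univ) = 0 := by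
  classical
  have hAk : A.card + k₀ ≤ n := huA ▸ hu
  -- the weight block of `(A, k₀)`
  have hblock := grenet_tangency_weightSplit e (fun j => (Pi.single (Sum.inl j) 1 : Fin n ⊕ Fin n → ℕ))
    (fun c => (Pi.single (Sum.inr c) 1 : Fin n ⊕ Fin n → ℕ)) hn hN A' htr
    (Sum.elim (fun j : Fin n => 1 + if j ∈ A then 1 else 0)
        (fun c : Fin n => 1 + if k₀ ≤ (c : ℕ) ∧ (c : ℕ) < A.card + k₀ then 1 else 0) : Fin n ⊕ Fin n → ℕ)
  have h := congrArg (eval P) hblock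
  rw [map_sum, map_zero] at h
  have h' : ∑ x ∈ (univ : Finset (Fin N × Fin N × (Fin n × Fin n))).filter (fun x => ((∑ j ∈ e.symm ((e univ).succAbove x.1), (Pi.single (Sum.inl j) 1 : Fin n ⊕ Fin n → ℕ) +
          ∑ j ∈ (e.symm ((e ∅).succAbove x.2.1))ᶜ, (Pi.single (Sum.inl j) 1 : Fin n ⊕ Fin n → ℕ)) +
        (∑ c ∈ univ.filter (fun c : Fin n => (c : ℕ) < (e.symm ((e univ).succAbove x.1)).card),
            (Pi.single (Sum.inr c) 1 : Fin n ⊕ Fin n → ℕ) +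
          ∑ c ∈ univ.filter (fun c : Fin n => (e.symm ((e ∅).succAbove x.2.1)).card ≤ (c : ℕ)),
            (Pi.single (Sum.inr c) 1 : Fin n ⊕ Fin n → ℕ)) +
        ((Pi.single (Sum.inl x.2.2.1) 1 : Fin n ⊕ Fin n → ℕ) + (Pi.single (Sum.inr x.2.2.2) 1 : Fin n ⊕ Fin n → ℕ))) = (Sum.elim (fun j : Fin n => 1 + if j ∈ A then 1 else 0)
        (fun c : Fin n => 1 + if k₀ ≤ (c : ℕ) ∧ (c : ℕ) < A.card + k₀ then 1 else 0) : Fin n ⊕ Fin n → ℕ)),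
      A' x.2.2 x.1 x.2.1 * eval P (perPoly (Fin n) k * (1 - Grenet.adj k n).adjugate (e.symm ((e ∅).succAbove x.2.1)) (e.symm ((e univ).succAbove x.1)) * X x.2.2
          - (1 - Grenet.adj k n).adjugate ∅ (e.symm ((e univ).succAbove x.1)) * X x.2.2
            * (1 - Grenet.adj k n).adjugate (e.symm ((e ∅).succAbove x.2.1)) univ) = 0 := by
    rw [← h]
    exact Finset.sum_congr rfl fun x _ => by rw [map_mul, eval_C]
  -- membership in the block, read through `weightE_eq_iff`
  have hmem : ∀ x : Fin N × Fin N × (Fin n × Fin n),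
      x ∈ (univ : Finset (Fin N × Fin N × (Fin n × Fin n))).filter (fun x => ((∑ j ∈ e.symm ((e univ).succAbove x.1), (Pi.single (Sum.inl j) 1 : Fin n ⊕ Fin n → ℕ) +
          ∑ j ∈ (e.symm ((e ∅).succAbove x.2.1))ᶜ, (Pi.single (Sum.inl j) 1 : Fin n ⊕ Fin n → ℕ)) +
        (∑ c ∈ univ.filter (fun c : Fin n => (c : ℕ) < (e.symm ((e univ).succAbove x.1)).card),
            (Pi.single (Sum.inr c) 1 : Fin n ⊕ Fin n → ℕ) +
          ∑ c ∈ univ.filter (fun c : Fin n => (e.symm ((e ∅).succAbove x.2.1)).card ≤ (c : ℕ)),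
            (Pi.single (Sum.inr c) 1 : Fin n ⊕ Fin n → ℕ)) +
        ((Pi.single (Sum.inl x.2.2.1) 1 : Fin n ⊕ Fin n → ℕ) + (Pi.single (Sum.inr x.2.2.2) 1 : Fin n ⊕ Fin n → ℕ))) = (Sum.elim (fun j : Fin n => 1 + if j ∈ A then 1 else 0)
        (fun c : Fin n => 1 + if k₀ ≤ (c : ℕ) ∧ (c : ℕ) < A.card + k₀ then 1 else 0) : Fin n ⊕ Fin n → ℕ)) ↔
      ((∀ j' : Fin n, (if j' ∈ e.symm ((e univ).succAbove x.1) then 1 else 0) + (if j' ∈ e.symm ((e ∅).succAbove x.2.1) then 0 else 1)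
          + (if j' = x.2.2.1 then 1 else 0) = 1 + (if j' ∈ A then 1 else 0)) ∧
        (∀ c' : Fin n, (if (c' : ℕ) < (e.symm ((e univ).succAbove x.1)).card then 1 else 0) + (if (e.symm ((e ∅).succAbove x.2.1)).card ≤ (c' : ℕ) then 1 else 0)
          + (if c' = x.2.2.2 then 1 else 0) = 1 + (if k₀ ≤ (c' : ℕ) ∧ (c' : ℕ) < A.card + k₀ then 1 else 0))) := by
    intro x
    rw [Finset.mem_filter, and_iff_right (Finset.mem_univ _), weightE_eq_iff]
    simp only [Sum.elim_inl, Sum.elim_inr]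
  -- tail-shaped and head-shaped entries lie in the block
  have hsubT : (univ.filter fun x : Fin N × Fin N × (Fin n × Fin n) => (x.2.2.1 ∉ e.symm ((e univ).succAbove x.1) ∧ e.symm ((e ∅).succAbove x.2.1) ⊆ Aᶜ ∧
        (e.symm ((e ∅).succAbove x.2.1)).card = k₀ ∧
        insert x.2.2.1 (e.symm ((e univ).succAbove x.1)) = A ∪ e.symm ((e ∅).succAbove x.2.1) ∧ (x.2.2.2 : ℕ) = u - 1)) ⊆
      (univ : Finset (Fin N × Fin N × (Fin n × Fin n))).filter (fun x => ((∑ j ∈ e.symm ((e univ).succAbove x.1), (Pi.single (Sum.inl j) 1 : Fin n ⊕ Fin n → ℕ) +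
          ∑ j ∈ (e.symm ((e ∅).succAbove x.2.1))ᶜ, (Pi.single (Sum.inl j) 1 : Fin n ⊕ Fin n → ℕ)) +
        (∑ c ∈ univ.filter (fun c : Fin n => (c : ℕ) < (e.symm ((e univ).succAbove x.1)).card),
            (Pi.single (Sum.inr c) 1 : Fin n ⊕ Fin n → ℕ) +
          ∑ c ∈ univ.filter (fun c : Fin n => (e.symm ((e ∅).succAbove x.2.1)).card ≤ (c : ℕ)),
            (Pi.single (Sum.inr c) 1 : Fin n ⊕ Fin n → ℕ)) +
        ((Pi.single (Sum.inl x.2.2.1) 1 : Fin n ⊕ Fin n → ℕ) + (Pi.single (Sum.inr x.2.2.2) 1 : Fin n ⊕ Fin n → ℕ))) = (Sum.elim (fun j : Fin n => 1 + if j ∈ A then 1 else 0)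
        (fun c : Fin n => 1 + if k₀ ≤ (c : ℕ) ∧ (c : ℕ) < A.card + k₀ then 1 else 0) : Fin n ⊕ Fin n → ℕ)) := by
    intro x hx
    obtain ⟨h1, h2, h3, h4, h5⟩ := (Finset.mem_filter.mp hx).2
    exact (hmem x).mpr (blockII_weight_of_tail A (e.symm ((e ∅).succAbove x.2.1)) (e.symm ((e univ).succAbove x.1)) hA h2 h3 x.2.2 h1 h4 (by omega))
  have hsubH : (univ.filter fun x : Fin N × Fin N × (Fin n × Fin n) => (x.2.2.1 ∈ e.symm ((e ∅).succAbove x.2.1) ∧ (e.symm ((e ∅).succAbove x.2.1)).erase x.2.2.1 ⊆ Aᶜ ∧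
        ((e.symm ((e ∅).succAbove x.2.1)).erase x.2.2.1).card = k₀ ∧
        e.symm ((e univ).succAbove x.1) = A ∪ (e.symm ((e ∅).succAbove x.2.1)).erase x.2.2.1 ∧ (x.2.2.2 : ℕ) = k₀)) ⊆
      (univ : Finset (Fin N × Fin N × (Fin n × Fin n))).filter (fun x => ((∑ j ∈ e.symm ((e univ).succAbove x.1), (Pi.single (Sum.inl j) 1 : Fin n ⊕ Fin n → ℕ) +
          ∑ j ∈ (e.symm ((e ∅).succAbove x.2.1))ᶜ, (Pi.single (Sum.inl j) 1 : Fin n ⊕ Fin n → ℕ)) +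
        (∑ c ∈ univ.filter (fun c : Fin n => (c : ℕ) < (e.symm ((e univ).succAbove x.1)).card),
            (Pi.single (Sum.inr c) 1 : Fin n ⊕ Fin n → ℕ) +
          ∑ c ∈ univ.filter (fun c : Fin n => (e.symm ((e ∅).succAbove x.2.1)).card ≤ (c : ℕ)),
            (Pi.single (Sum.inr c) 1 : Fin n ⊕ Fin n → ℕ)) +
        ((Pi.single (Sum.inl x.2.2.1) 1 : Fin n ⊕ Fin n → ℕ) + (Pi.single (Sum.inr x.2.2.2) 1 : Fin n ⊕ Fin n → ℕ))) = (Sum.elim (fun j : Fin n => 1 + if j ∈ A then 1 else 0)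
        (fun c : Fin n => 1 + if k₀ ≤ (c : ℕ) ∧ (c : ℕ) < A.card + k₀ then 1 else 0) : Fin n ⊕ Fin n → ℕ)) := by
    intro x hx
    obtain ⟨h1, h2, h3, h4, h5⟩ := (Finset.mem_filter.mp hx).2
    have hw := blockII_weight_of_head A ((e.symm ((e ∅).succAbove x.2.1)).erase x.2.2.1) (e.symm ((e ∅).succAbove x.2.1)) hA h2 h3 x.2.2 h1 rfl h5
    rw [← h4] at hw
    exact (hmem x).mpr hw
  -- off the two shapes the entries vanish (support condition + the shape lemmas)
  have hzero : ∀ x ∈ (univ : Finset (Fin N × Fin N × (Fin n × Fin n))).filter (fun x => ((∑ j ∈ e.symm ((e univ).succAbove x.1), (Pi.single (Sum.inl j) 1 : Fin n ⊕ Fin n → ℕ) +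
          ∑ j ∈ (e.symm ((e ∅).succAbove x.2.1))ᶜ, (Pi.single (Sum.inl j) 1 : Fin n ⊕ Fin n → ℕ)) +
        (∑ c ∈ univ.filter (fun c : Fin n => (c : ℕ) < (e.symm ((e univ).succAbove x.1)).card),
            (Pi.single (Sum.inr c) 1 : Fin n ⊕ Fin n → ℕ) +
          ∑ c ∈ univ.filter (fun c : Fin n => (e.symm ((e ∅).succAbove x.2.1)).card ≤ (c : ℕ)),
            (Pi.single (Sum.inr c) 1 : Fin n ⊕ Fin n → ℕ)) +
        ((Pi.single (Sum.inl x.2.2.1) 1 : Fin n ⊕ Fin n → ℕ) + (Pi.single (Sum.inr x.2.2.2) 1 : Fin n ⊕ Fin n → ℕ))) = (Sum.elim (fun j : Fin n => 1 + if j ∈ A then 1 else 0)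
        (fun c : Fin n => 1 + if k₀ ≤ (c : ℕ) ∧ (c : ℕ) < A.card + k₀ then 1 else 0) : Fin n ⊕ Fin n → ℕ)),
      x ∉ (univ.filter fun x : Fin N × Fin N × (Fin n × Fin n) => (x.2.2.1 ∉ e.symm ((e univ).succAbove x.1) ∧ e.symm ((e ∅).succAbove x.2.1) ⊆ Aᶜ ∧
        (e.symm ((e ∅).succAbove x.2.1)).card = k₀ ∧
        insert x.2.2.1 (e.symm ((e univ).succAbove x.1)) = A ∪ e.symm ((e ∅).succAbove x.2.1) ∧ (x.2.2.2 : ℕ) = u - 1)) ∪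
        (univ.filter fun x : Fin N × Fin N × (Fin n × Fin n) => (x.2.2.1 ∈ e.symm ((e ∅).succAbove x.2.1) ∧ (e.symm ((e ∅).succAbove x.2.1)).erase x.2.2.1 ⊆ Aᶜ ∧
        ((e.symm ((e ∅).succAbove x.2.1)).erase x.2.2.1).card = k₀ ∧
        e.symm ((e univ).succAbove x.1) = A ∪ (e.symm ((e ∅).succAbove x.2.1)).erase x.2.2.1 ∧ (x.2.2.2 : ℕ) = k₀)) →
      A' x.2.2 x.1 x.2.1 * eval P (perPoly (Fin n) k * (1 - Grenet.adj k n).adjugate (e.symm ((e ∅).succAbove x.2.1)) (e.symm ((e univ).succAbove x.1)) * X x.2.2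
          - (1 - Grenet.adj k n).adjugate ∅ (e.symm ((e univ).succAbove x.1)) * X x.2.2
            * (1 - Grenet.adj k n).adjugate (e.symm ((e ∅).succAbove x.2.1)) univ) = 0 := by
    intro x hx hx'
    by_cases hz : A' x.2.2 x.1 x.2.1 = 0
    · rw [hz, zero_mul]
    exfalso
    obtain ⟨hrow, hcol⟩ := (hmem x).mp hx
    refine hx' (Finset.mem_union.mpr ?_)
    rcases hsupp x.2.2 x.1 x.2.1 hz with ht | hh
    · left
      obtain ⟨g1, g2, g3, g4⟩ := blockII_tail_shape A (e.symm ((e univ).succAbove x.1)) (e.symm ((e ∅).succAbove x.2.1)) k₀ hA hAk x.2.2 ht hrow hcol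
      exact Finset.mem_filter.mpr ⟨Finset.mem_univ _, ht.1, g1, g2, g3, by omega⟩
    · right
      obtain ⟨g1, g2, g3, g4⟩ := blockII_head_shape A (e.symm ((e univ).succAbove x.1)) (e.symm ((e ∅).succAbove x.2.1)) k₀ hA hAk x.2.2 hh hrow hcol
      exact Finset.mem_filter.mpr ⟨Finset.mem_univ _, hh.1, g1, g2, g3, g4⟩
  rw [← Finset.sum_union (blockII_disjoint_shapes e A k₀ u),
    Finset.sum_subset (Finset.union_subset hsubT hsubH) hzero]
  exact h'

end Summit.ValiantsHypothesis.Theorems.RigidityForcesSymmetry.GrenetGauge
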